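import Summits.AtomisticToContinuum.FouriersLaw.Theorems.BondHeatUncertaintySubdiffusiveBondHeatSiteEnergyDynkinTruncation
import Summits.AtomisticToContinuum.FouriersLaw.Theorems.HonestZwanzigParityStaticsSiteEnergyGenerator
import Summits.AtomisticToContinuum.FouriersLaw.Theorems.HonestZwanzigParityStaticsSiteEnergyBounds

/-!
# `HonestZwanzig.FeshbachIdentities`, site energies part 1: niceness, the generator image, a witness of non-constancy

Support file for item `stmt-AtomisticToContinuum-12697` (`HonestZwanzig.FeshbachIdentities`). The SYMMETRICALLY SPLIT
site energies of route `HonestZwanzig`, `e_x = p_x²/2 + U(q_x) + ½∑_j([j=x+1]V(q_j - q_x) + [x=j+1]V(q_x - q_j))`, are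
handled through an abstract family `e : Fin N → PhaseSpace N → ℝ` with its defining equation `he` (so statements stay
short; at the route one takes `e := fun x z => …` and `he := fun _ _ => rfl`). For the pinned anharmonic chain
`pinnedChain ω₂ lam β γ` (`ω₂ > 0`, `lam, β, γ ≥ 0`), equal bath temperatures `T ≥ 0` (Dynkin's identity is part 2):

* `pinnedChain_splitSite_nice` — `e_x` is continuous, even in the momenta and `|e_x| ≤ ((N+2)/ϑ) e^{ϑH}` (`ϑ > 0`);
* `pinnedChain_generator_splitSite_nice` — `L e_x` (closed form `pinnedChain_generator_splitSiteEnergy` of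
  `…ParityStaticsSiteEnergyGenerator`: net bond current into `x` plus bath heat) is continuous and `O(e^{ϑH})`;
* `pinnedChain_sum_splitSite_witness` — `∑ ξ_x e_x` separates the points `(0,0)` and `(0, δ_{x₀})` when `ξ_{x₀} ≠ 0`.
-/

noncomputable section

open MeasureTheory ProbabilityTheory Filter Topology Set Function
open scoped NNReal ENNReal
open Literature.MathematicalPhysics.KineticTheory.HeatConduction
open Literature.MathematicalPhysics.KineticTheory Literature.Probability.Process OscillatorChain
open Summit.AtomisticToContinuum.FouriersLaw.Theorems.SubdiffusiveBondHeat

namespace Summit.AtomisticToContinuum.FouriersLaw.Theorems.HonestZwanzig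

variable {N : ℕ}

section SplitSite

variable {ω₂ lam β γ : ℝ} (e : Fin N → PhaseSpace N → ℝ)
  (he : ∀ x z, e x z = z.2 x ^ 2 / 2 + (pinnedChain ω₂ lam β γ).U (z.1 x) +
    ∑ j : Fin N, ((if j.val = x.val + 1 then (pinnedChain ω₂ lam β γ).V (z.1 j - z.1 x) / 2 else 0) +
      (if x.val = j.val + 1 then (pinnedChain ω₂ lam β γ).V (z.1 x - z.1 j) / 2 else 0)))
include he

/-! ### Static facts -/

/-- `e_x` as the literal split site energy. -/
theorem splitSite_eq (x : Fin N) : e x = fun z : PhaseSpace N => z.2 x ^ 2 / 2 + (pinnedChain ω₂ lam β γ).U (z.1 x) +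
    ∑ j : Fin N, ((if j.val = x.val + 1 then (pinnedChain ω₂ lam β γ).V (z.1 j - z.1 x) / 2 else 0) +
      (if x.val = j.val + 1 then (pinnedChain ω₂ lam β γ).V (z.1 x - z.1 j) / 2 else 0)) :=
  funext (he x)

/-- **The split site energies are nice**: continuous, even in the momenta, `0 ≤ e_x ≤ (N+2)H`, and
`|e_x| ≤ ((N+2)/ϑ) e^{ϑH}` for every `ϑ > 0` (`ω₂ > 0`, `lam, β ≥ 0`). [folklore] -/
theorem pinnedChain_splitSite_nice (hω : 0 < ω₂) (hl : 0 ≤ lam) (hβ : 0 ≤ β) (x : Fin N) :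
    Continuous (e x) ∧ (∀ z : PhaseSpace N, e x (z.1, -z.2) = e x z) ∧
    (∀ z, 0 ≤ e x z ∧ e x z ≤ ((N : ℝ) + 2) * (pinnedChain ω₂ lam β γ).hamiltonian N z) ∧
    ∀ ϑ : ℝ, 0 < ϑ → ∀ z, |e x z| ≤ ((N : ℝ) + 2) / ϑ * Real.exp (ϑ * (pinnedChain ω₂ lam β γ).hamiltonian N z) := by
  refine ⟨?_, fun z => ?_, fun z => ⟨?_, ?_⟩, fun ϑ hϑ z => ?_⟩
  · rw [splitSite_eq e he x]; exact pinnedChain_continuous_splitSiteEnergy ω₂ lam β γ N x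
  · rw [he, he]; simp
  · rw [he]; exact pinnedChain_splitSiteEnergy_nonneg hω.le hl hβ γ N x z
  · rw [he]; exact pinnedChain_splitSiteEnergy_le hω.le hl hβ γ N x z
  · have h0 : 0 ≤ e x z := by rw [he]; exact pinnedChain_splitSiteEnergy_nonneg hω.le hl hβ γ N x z
    have h1 : e x z ≤ ((N : ℝ) + 2) * (pinnedChain ω₂ lam β γ).hamiltonian N z := by
      rw [he]; exact pinnedChain_splitSiteEnergy_le hω.le hl hβ γ N x z
    set Hz := (pinnedChain ω₂ lam β γ).hamiltonian N z
    have hH0 : 0 ≤ Hz := pinnedChain_hamiltonian_nonneg hω.le hl hβ γ N z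
    have hexp : ϑ * Hz + 1 ≤ Real.exp (ϑ * Hz) := Real.add_one_le_exp _
    have hHle : Hz ≤ Real.exp (ϑ * Hz) / ϑ := by rw [le_div_iff₀ hϑ]; nlinarith
    rw [abs_of_nonneg h0]
    calc e x z ≤ ((N : ℝ) + 2) * Hz := h1
      _ ≤ ((N : ℝ) + 2) * (Real.exp (ϑ * Hz) / ϑ) := mul_le_mul_of_nonneg_left hHle (by positivity)
      _ = ((N : ℝ) + 2) / ϑ * Real.exp (ϑ * Hz) := by ring

/-- `∂_{p_i} e_x = [i = x] p_i`. [folklore] -/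
theorem partialP_splitSite (x i : Fin N) (z : PhaseSpace N) :
    partialP i (e x) z = (if i = x then (1 : ℝ) else 0) * z.2 i := by
  rw [splitSite_eq e he x, splitSiteEnergy_eq_energyProfile _ x, partialP_energyProfile]

/-- **The generator image of `e_x`** (closed form, `…ParityStaticsSiteEnergyGenerator`), its continuity and the bound
`|L e_x| ≤ (N²(3+β) + (2T+4)γ)(1+H)²` (`T_L = T_R = T ≥ 0`, `γ ≥ 0`). [folklore] -/
theorem pinnedChain_generator_splitSite_nice (hω : 0 < ω₂) (hl : 0 ≤ lam) (hβ : 0 ≤ β) (hγ : 0 ≤ γ) {T : ℝ}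
    (hT : 0 ≤ T) (x : Fin N) :
    (∀ z, (pinnedChain ω₂ lam β γ).generator N T T (e x) z =
      (∑ b : Fin N, ((if x.val = b.val + 1 then (pinnedChain ω₂ lam β γ).bondCurrent N b z else 0) -
        (if b = x then (pinnedChain ω₂ lam β γ).bondCurrent N b z else 0))) +
      (if x.val = 0 then γ * (T - z.2 x ^ 2) else 0) + (if x.val = N - 1 then γ * (T - z.2 x ^ 2) else 0)) ∧
    Continuous ((pinnedChain ω₂ lam β γ).generator N T T (e x)) ∧
    ∀ z, |(pinnedChain ω₂ lam β γ).generator N T T (e x) z| ≤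
      ((N : ℝ) ^ 2 * (3 + β) + (2 * T + 4) * γ) * (1 + (pinnedChain ω₂ lam β γ).hamiltonian N z) ^ 2 := by
  have hgen : ∀ z, (pinnedChain ω₂ lam β γ).generator N T T (e x) z =
      (∑ b : Fin N, ((if x.val = b.val + 1 then (pinnedChain ω₂ lam β γ).bondCurrent N b z else 0) -
        (if b = x then (pinnedChain ω₂ lam β γ).bondCurrent N b z else 0))) +
      (if x.val = 0 then γ * (T - z.2 x ^ 2) else 0) + (if x.val = N - 1 then γ * (T - z.2 x ^ 2) else 0) := by
    intro z
    rw [splitSite_eq e he x]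
    exact pinnedChain_generator_splitSiteEnergy ω₂ lam β γ N T T x z
  refine ⟨hgen, ?_, fun z => ?_⟩
  · have hfun : (pinnedChain ω₂ lam β γ).generator N T T (e x) = fun z =>
        (∑ b : Fin N, ((if x.val = b.val + 1 then (pinnedChain ω₂ lam β γ).bondCurrent N b z else 0) -
          (if b = x then (pinnedChain ω₂ lam β γ).bondCurrent N b z else 0))) +
        (if x.val = 0 then γ * (T - z.2 x ^ 2) else 0) + (if x.val = N - 1 then γ * (T - z.2 x ^ 2) else 0) :=
      funext hgen
    rw [hfun]
    refine ((pinnedChain_continuous_bondCurrentDivergence ω₂ lam β γ N x).add ?_).add ?_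
    · by_cases h : x.val = 0
      · simp only [h, if_true]; fun_prop
      · simp only [h, if_false]; exact continuous_const
    · by_cases h : x.val = N - 1
      · simp only [h, if_true]; fun_prop
      · simp only [h, if_false]; exact continuous_const
  · rw [hgen z]
    have hD := pinnedChain_abs_bondCurrentDivergence_le hω.le hl hβ γ N x z
    have hp : z.2 x ^ 2 ≤ 2 * (pinnedChain ω₂ lam β γ).hamiltonian N z := pinnedChain_sq_momentum_le hω.le hl hβ γ N z x
    have hH0 := pinnedChain_hamiltonian_nonneg hω.le hl hβ γ N z
    set Hz := (pinnedChain ω₂ lam β γ).hamiltonian N z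
    have hbath : ∀ c : Prop, ∀ _ : Decidable c, |(if c then γ * (T - z.2 x ^ 2) else 0)| ≤ (T + 2) * γ * (1 + Hz) ^ 2 := by
      intro c _
      split_ifs
      · rw [abs_mul, abs_of_nonneg hγ]
        have : |T - z.2 x ^ 2| ≤ T + 2 * Hz := by
          rw [abs_le]; constructor <;> nlinarith [sq_nonneg (z.2 x)]
        calc γ * |T - z.2 x ^ 2| ≤ γ * (T + 2 * Hz) := mul_le_mul_of_nonneg_left this hγ
          _ ≤ γ * ((T + 2) * (1 + Hz) ^ 2) := by
              apply mul_le_mul_of_nonneg_left _ hγ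
              nlinarith [mul_nonneg hT hH0, sq_nonneg Hz, mul_nonneg hT (sq_nonneg Hz)]
          _ = (T + 2) * γ * (1 + Hz) ^ 2 := by ring
      · rw [abs_zero]; positivity
    calc _ ≤ |∑ b : Fin N, ((if x.val = b.val + 1 then (pinnedChain ω₂ lam β γ).bondCurrent N b z else 0) -
          (if b = x then (pinnedChain ω₂ lam β γ).bondCurrent N b z else 0))| +
          |(if x.val = 0 then γ * (T - z.2 x ^ 2) else 0)| + |(if x.val = N - 1 then γ * (T - z.2 x ^ 2) else 0)| := by
            exact (abs_add_le _ _).trans (add_le_add (abs_add_le _ _) le_rfl)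
      _ ≤ (N : ℝ) ^ 2 * (3 + β) * (1 + Hz) ^ 2 + (T + 2) * γ * (1 + Hz) ^ 2 + (T + 2) * γ * (1 + Hz) ^ 2 :=
            add_le_add (add_le_add hD (hbath _ _)) (hbath _ _)
      _ = ((N : ℝ) ^ 2 * (3 + β) + (2 * T + 4) * γ) * (1 + Hz) ^ 2 := by ring

/-! ### A witness of non-constancy -/

/-- **`∑ ξ_x e_x` is not constant for `ξ ≠ 0`**: at `(q,p) = (0,0)` it vanishes and at `(0, δ_{x₀})` it equals
`ξ_{x₀}/2` (for the pinned chain `U(0) = V(0) = 0`). [folklore] -/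
theorem pinnedChain_sum_splitSite_witness {ξ : Fin N → ℝ} {x₀ : Fin N} (hξ : ξ x₀ ≠ 0) :
    ∑ x, ξ x * e x ((fun _ => 0, fun _ => 0) : PhaseSpace N) ≠
      ∑ x, ξ x * e x ((fun _ => 0, Pi.single x₀ 1) : PhaseSpace N) := by
  have hU0 : (pinnedChain ω₂ lam β γ).U 0 = 0 := by show ω₂ * 0 ^ 2 / 2 + lam * 0 ^ 4 / 4 = 0; ring
  have hV0 : (pinnedChain ω₂ lam β γ).V 0 = 0 := by show (0:ℝ) ^ 2 / 2 + β * 0 ^ 4 / 4 = 0; ring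
  have h0 : ∀ x, e x ((fun _ => 0, fun _ => 0) : PhaseSpace N) = 0 := fun x => by
    rw [he]; simp [hU0, hV0]
  have h1 : ∀ x, e x ((fun _ => 0, Pi.single x₀ 1) : PhaseSpace N) = if x = x₀ then 1 / 2 else 0 := fun x => by
    rw [he]
    simp only [sub_self, hU0, hV0, zero_div, ite_self, add_zero, Finset.sum_const_zero]
    by_cases hx : x = x₀
    · subst hx; simp
    · simp [hx]
  simp only [h0, h1, mul_zero, Finset.sum_const_zero, mul_ite, Finset.sum_ite_eq', Finset.mem_univ, if_true]
  intro h
  apply hξ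
  linarith

end SplitSite

end Summit.AtomisticToContinuum.FouriersLaw.Theorems.HonestZwanzig

end
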